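import Summits.CriticalPhenomena.CardyFormulaZ2.Theorems.CardyIKTransportIKLinearTransportTransportGlue
import Summits.CriticalPhenomena.CardyFormulaZ2.Theorems.CardyIKTransportIKLinearTransportScreeningGlue

/-!
# Stub `stub_FarRSWOfInputs` (crux stmt-CriticalPhenomena-5076 `CardyIKTransport.IKLinearTransport`, line
# `pinned-diagram-exchange`) — part 1 of 2: the ring event is determined by an enlarged box

Theorem-only support file (`--supports stmt-CriticalPhenomena-5076`, registered sub-goal
`farRSW_ring_mem_determinedOn`) for the skeleton stub `stub_FarRSWOfInputs` ("conditioning on far events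
is free": the unconditional far RSW family + density-form ratio mixing ⇒ the far-CONDITIONED family
`FarRSWBound c S n a b w h E`). This file supplies the two technical lemmas of the large-scale regime and the
all-black lemmas of the small-scale regime:

* `frsw_measurableSet_of_determinedOn_finset` — an event of observables determined by FINITELY many cells is
  measurable (it is a finite union of the window fibres `Lift.fib` of `…CouplingLift2`), and its box form
  `frsw_measurableSet_of_determinedOn_box`;
* `farRSW_ring_mem_determinedOn` (registered) — THE RING EVENT AT SCALE `d` ("no white path from the
  `w × h` box at `(a, b)` reaches sup-distance `≥ d`") IS DETERMINED BY THE BOX ENLARGED BY `d + 2`: a white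
  path from the box to the far region contains a sub-walk from a box cell to its FIRST far cell (or, read
  backwards, from its LAST far cell before the box cell), all of whose cells lie at sup-distance `≤ d + 1`
  (`frsw_exists_chain_to_far`, `frsw_exists_short_witness`: an induction on the list; `cellGraph`-neighbours
  differ by `≤ 1` in each coordinate, `frsw_cellGraph_adj_coord`); such a walk reads only the cells and faces
  of the enlarged box (`Lift.monoPaths_congr`);
* `frsw_mem_lrCross_of_allBlack`, `frsw_mem_tbCross_of_allBlack` — an all-black `w × h` box (`w, h ≥ 1`) is
  crossed both ways, whatever the diagonals (generalising `crsw_mem_lrCross_of_allBlack`).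
-/

noncomputable section

namespace Summit.CriticalPhenomena.CardyFormulaZ2.Theorems.IKLinearTransport.PinnedDiagramExchange

open scoped BigOperators Topology Classical MeasureTheory ProbabilityTheory ENNReal
open Filter Set Function MeasureTheory
open Literature.Probability.Percolation Literature.Probability.LatticeModels
open Literature.Probability.RandomPlanarGeometry

/-! ## §1 Events determined by finitely many cells are measurable -/

/-- An event of observables determined by the cells and faces of a FINITE set `Λf` is measurable: it is the
(finite) union of the window fibres `Lift.fib Λf w` it meets. [folklore] -/
theorem frsw_measurableSet_of_determinedOn_finset (Λf : Finset (Site 2)) {E : Set Obs}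
    (hE : E ∈ determinedOn (↑Λf : Set (Site 2))) : MeasurableSet E := by
  have key : E = ⋃ w ∈ (Lift.winData Λf).filter (fun w => ∃ z ∈ Lift.fib Λf w, z ∈ E), Lift.fib Λf w := by
    refine Set.ext fun x => ⟨fun hx => ?_, fun hx => ?_⟩
    · refine Set.mem_iUnion₂.2 ⟨Lift.res Λf x, ?_, Lift.mem_fib_res Λf x⟩
      exact Finset.mem_filter.2 ⟨Lift.res_mem Λf x, x, Lift.mem_fib_res Λf x, hx⟩
    · obtain ⟨w, hw, hxw⟩ := Set.mem_iUnion₂.1 hx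
      obtain ⟨-, z, hz, hzE⟩ := Finset.mem_filter.1 hw
      exact (hE z x (Lift.agree_of_mem_fib Λf hz hxw)).1 hzE
  rw [key]
  exact Finset.measurableSet_biUnion _ fun w _ => Lift.measurableSet_fib Λf w

/-- The finite set of cells of the box `[a, a+w) × [b, b+h)`, as a set. [folklore] -/
theorem frsw_coe_boxCells (a b : ℤ) (w h : ℕ) :
    (↑(((Finset.Ico a (a + w)) ×ˢ (Finset.Ico b (b + h))).image
        (fun p : ℤ × ℤ => (![p.1, p.2] : Site 2))) : Set (Site 2)) =
      {v : Site 2 | a ≤ v 0 ∧ v 0 < a + w ∧ b ≤ v 1 ∧ v 1 < b + h} :=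
  Set.ext fun c => (Finset.mem_coe.trans (crsw_mem_boxCells_iff a b w h c))

/-- An event of observables determined by the cells and faces of a box is measurable. [folklore] -/
theorem frsw_measurableSet_of_determinedOn_box (a b : ℤ) (w h : ℕ) {E : Set Obs}
    (hE : E ∈ determinedOn {v : Site 2 | a ≤ v 0 ∧ v 0 < a + w ∧ b ≤ v 1 ∧ v 1 < b + h}) :
    MeasurableSet E :=
  frsw_measurableSet_of_determinedOn_finset _ (by rwa [frsw_coe_boxCells])

/-! ## §2 Path surgery: the ring event is determined by an enlarged box -/

/-- Neighbours in the triangulation differ by at most `1` in each coordinate. [folklore] -/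
theorem frsw_cellGraph_adj_coord {A : Set (Site 2)} {u v : Site 2} (huv : (cellGraph A).Adj u v) :
    u 0 ≤ v 0 + 1 ∧ v 0 ≤ u 0 + 1 ∧ u 1 ≤ v 1 + 1 ∧ v 1 ≤ u 1 + 1 := by
  obtain ⟨-, hr | hr⟩ := (SimpleGraph.fromRel_adj _ _ _).1 huv
  · rcases hr with h1 | h1 | ⟨h1, -⟩ | ⟨h1, -⟩ <;> subst h1 <;>
      simp only [Pi.add_apply, Matrix.cons_val_zero, Matrix.cons_val_one, Matrix.cons_val_fin_one] <;>
      omega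
  · rcases hr with h1 | h1 | ⟨h1, -⟩ | ⟨h1, -⟩ <;> subst h1 <;>
      simp only [Pi.add_apply, Matrix.cons_val_zero, Matrix.cons_val_one, Matrix.cons_val_fin_one] <;>
      omega

/-- PREFIX EXTRACTION. In a chain starting at a cell `c` that is not far and containing a far cell, the
initial segment up to the FIRST far cell is a chain from `c` to a far cell all of whose cells satisfy `N'`,
provided non-far cells and the neighbours of non-far cells satisfy `N'`. [folklore] -/
theorem frsw_exists_chain_to_far {α : Type*} {R : α → α → Prop} {F N' : α → Prop}
    (hN : ∀ u, ¬ F u → N' u) (hRN : ∀ u v, R u v → ¬ F u → N' v) (rest : List α) :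
    ∀ c : α, List.IsChain R (c :: rest) → ¬ F c → (∃ v ∈ c :: rest, F v) →
      ∃ q : List α, List.IsChain R (c :: q) ∧ (∀ z ∈ q, z ∈ rest) ∧ (∀ z ∈ c :: q, N' z) ∧
        ∃ v ∈ q, F v := by
  induction rest with
  | nil =>
    rintro c - hc ⟨v, hv, hvF⟩
    rw [List.mem_singleton] at hv
    exact absurd (hv ▸ hvF) hc
  | cons c' rest' ih =>
    rintro c hchain hc ⟨v, hv, hvF⟩
    obtain ⟨hcc', hrest⟩ := List.isChain_cons_cons.1 hchain
    by_cases hc'F : F c'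
    · refine ⟨[c'], List.isChain_cons_cons.2 ⟨hcc', List.isChain_singleton c'⟩, fun z hz => ?_,
        fun z hz => ?_, c', List.mem_singleton_self c', hc'F⟩
      · rw [List.mem_singleton] at hz
        subst hz
        exact List.mem_cons_self
      · rcases List.mem_cons.1 hz with rfl | hz
        · exact hN _ hc
        · rw [List.mem_singleton] at hz
          subst hz
          exact hRN _ _ hcc' hc
    · have hv' : v ∈ c' :: rest' := by
        rcases List.mem_cons.1 hv with rfl | hv
        · exact absurd hvF hc
        · exact hv
      obtain ⟨q', hq'c, hq'sub, hq'N, v', hv'q, hv'F⟩ := ih c' hrest hc'F ⟨v, hv', hvF⟩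
      refine ⟨c' :: q', List.isChain_cons_cons.2 ⟨hcc', hq'c⟩, fun z hz => ?_, fun z hz => ?_,
        v', List.mem_cons_of_mem _ hv'q, hv'F⟩
      · rcases List.mem_cons.1 hz with rfl | hz
        · exact List.mem_cons_self
        · exact List.mem_cons_of_mem _ (hq'sub z hz)
      · rcases List.mem_cons.1 hz with rfl | hz
        · exact hN _ hc
        · exact hq'N z hz

/-- SHORT WITNESSES. A chain of a simple graph through a cell satisfying `B` and a far cell contains a
sub-chain through a `B`-cell and a far cell all of whose cells satisfy `N'` (from the `B`-cell forwards to
the first far cell after it, or backwards to the last far cell before it), provided `B`-cells are not far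
and non-far cells and their neighbours satisfy `N'`. [folklore] -/
theorem frsw_exists_short_witness {α : Type*} (G : SimpleGraph α) {F N' B : α → Prop}
    (hN : ∀ u, ¬ F u → N' u) (hRN : ∀ u v, G.Adj u v → ¬ F u → N' v) (hBF : ∀ u, B u → ¬ F u)
    {l : List α} (hl : List.IsChain G.Adj l) {u : α} (hu : u ∈ l) (huB : B u) {v : α} (hv : v ∈ l)
    (hvF : F v) :
    ∃ q : List α, q ≠ [] ∧ List.IsChain G.Adj q ∧ (∀ z ∈ q, z ∈ l) ∧ (∀ z ∈ q, N' z) ∧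
      (∃ u ∈ q, B u) ∧ ∃ v ∈ q, F v := by
  obtain ⟨s, t, rfl⟩ := List.append_of_mem hu
  obtain ⟨hleft, hright⟩ := List.isChain_split.1 hl
  rcases List.mem_append.1 hv with hvs | hvt
  · -- the far cell comes first: read the initial segment backwards
    have hrev : List.IsChain G.Adj (u :: s.reverse) := by
      have h1 : (s ++ [u]).reverse = u :: s.reverse := by simp
      rw [← h1, List.isChain_reverse]
      exact hleft.imp fun a b h => h.symm
    obtain ⟨q, hqc, hqsub, hqN, v', hv'q, hv'F⟩ := frsw_exists_chain_to_far hN hRN s.reverse u hrev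
      (hBF u huB) ⟨v, List.mem_cons_of_mem _ (List.mem_reverse.2 hvs), hvF⟩
    refine ⟨u :: q, List.cons_ne_nil _ _, hqc, fun z hz => ?_, hqN, ⟨u, List.mem_cons_self, huB⟩,
      v', List.mem_cons_of_mem _ hv'q, hv'F⟩
    rcases List.mem_cons.1 hz with rfl | hz
    · exact List.mem_append_right _ List.mem_cons_self
    · exact List.mem_append_left _ (List.mem_reverse.1 (hqsub z hz))
  · -- the far cell comes after the `B`-cell
    obtain ⟨q, hqc, hqsub, hqN, v', hv'q, hv'F⟩ := frsw_exists_chain_to_far hN hRN t u hright (hBF u huB)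
      ⟨v, hvt, hvF⟩
    refine ⟨u :: q, List.cons_ne_nil _ _, hqc, fun z hz => ?_, hqN, ⟨u, List.mem_cons_self, huB⟩,
      v', List.mem_cons_of_mem _ hv'q, hv'F⟩
    rcases List.mem_cons.1 hz with rfl | hz
    · exact List.mem_append_right _ List.mem_cons_self
    · exact List.mem_append_right _ (List.mem_cons_of_mem _ (hqsub z hz))

/-- TRANSFER OF RING WITNESSES along agreement on the box enlarged by `d + 2`: if `x` and `y` agree on the
cells and faces of `[a-d-2, a+w+d+2) × [b-d-2, b+h+d+2)` and some white path of `x` joins the `w × h` box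
at `(a, b)` to sup-distance `≥ d`, so does some white path of `y`. [folklore] -/
theorem frsw_ring_witness_transfer {a b : ℤ} {w h d : ℕ} {x y : Obs}
    (hxy : Lift.Agree {v : Site 2 | a - d - 2 ≤ v 0 ∧ v 0 < a - d - 2 + ((w + 2 * d + 4 : ℕ) : ℤ) ∧
      b - d - 2 ≤ v 1 ∧ v 1 < b - d - 2 + ((h + 2 * d + 4 : ℕ) : ℤ)} x y)
    (hx : ∃ p ∈ monoPaths x false, (∃ u ∈ p, a ≤ u 0 ∧ u 0 < a + w ∧ b ≤ u 1 ∧ u 1 < b + h) ∧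
      ∃ v ∈ p, v ∈ farFrom a b w h d) :
    ∃ p ∈ monoPaths y false, (∃ u ∈ p, a ≤ u 0 ∧ u 0 < a + w ∧ b ≤ u 1 ∧ u 1 < b + h) ∧
      ∃ v ∈ p, v ∈ farFrom a b w h d := by
  obtain ⟨p, hp, ⟨u, hu, huB⟩, v, hv, hvF⟩ := hx
  obtain ⟨q, hqne, hqc, hqsub, hqN, hqB, hqF⟩ := frsw_exists_short_witness (cellGraph x.2)
    (F := fun z : Site 2 => z ∈ farFrom a b w h d)
    (N' := fun z : Site 2 => a - d - 1 ≤ z 0 ∧ z 0 < a + w + d + 1 ∧ b - d - 1 ≤ z 1 ∧ z 1 < b + h + d + 1)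
    (B := fun z : Site 2 => a ≤ z 0 ∧ z 0 < a + w ∧ b ≤ z 1 ∧ z 1 < b + h)
    (fun z hz => by
      simp only [farFrom, Set.mem_setOf_eq] at hz
      omega)
    (fun z z' hzz' hz => by
      have hc := frsw_cellGraph_adj_coord hzz'
      simp only [farFrom, Set.mem_setOf_eq] at hz
      omega)
    (fun z hz hzF => by
      simp only [farFrom, Set.mem_setOf_eq] at hzF
      omega)
    hp.2.1 hu huB hv hvF
  have hqx : q ∈ monoPaths x false := ⟨hqne, hqc, fun z hz => hp.2.2 z (hqsub z hz)⟩
  refine ⟨q, Lift.monoPaths_congr hxy (fun z hz => ?_) hqx, hqB, hqF⟩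
  have hz' := hqN z hz
  simp only [Set.mem_setOf_eq, Pi.add_apply, Matrix.cons_val_zero, Matrix.cons_val_one,
    Matrix.cons_val_fin_one]
  push_cast
  omega

/-- **THE RING EVENT IS DETERMINED BY THE ENLARGED BOX** (registered sub-goal of `stub_FarRSWOfInputs`):
the event "no white path from the `w × h` box at `(a, b)` reaches sup-distance `≥ d` from it" (the third
event of `FarRSWBound`, at scale `d`) is determined by the cells and faces of the box
`[a-d-2, a+w+d+2) × [b-d-2, b+h+d+2)`. [folklore] -/
theorem farRSW_ring_mem_determinedOn : ∀ (a b : ℤ) (w h d : ℕ),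
    {x : Obs | ∀ p ∈ monoPaths x false, (∃ u ∈ p, a ≤ u 0 ∧ u 0 < a + w ∧ b ≤ u 1 ∧ u 1 < b + h) →
        ∀ v ∈ p, v ∉ farFrom a b w h d} ∈
      determinedOn {v : Site 2 | a - d - 2 ≤ v 0 ∧ v 0 < a - d - 2 + ((w + 2 * d + 4 : ℕ) : ℤ) ∧
        b - d - 2 ≤ v 1 ∧ v 1 < b - d - 2 + ((h + 2 * d + 4 : ℕ) : ℤ)} := by
  intro a b w h d x y hxy
  have hxy' : Lift.Agree {v : Site 2 | a - d - 2 ≤ v 0 ∧ v 0 < a - d - 2 + ((w + 2 * d + 4 : ℕ) : ℤ) ∧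
      b - d - 2 ≤ v 1 ∧ v 1 < b - d - 2 + ((h + 2 * d + 4 : ℕ) : ℤ)} x y := hxy
  constructor
  · intro hx p hp hpB v hv hvF
    obtain ⟨p', hp', hp'B, v', hv', hv'F⟩ := frsw_ring_witness_transfer hxy'.symm ⟨p, hp, hpB, v, hv, hvF⟩
    exact hx p' hp' hp'B v' hv' hv'F
  · intro hy p hp hpB v hv hvF
    obtain ⟨p', hp', hp'B, v', hv', hv'F⟩ := frsw_ring_witness_transfer hxy' ⟨p, hp, hpB, v, hv, hvF⟩
    exact hy p' hp' hp'B v' hv' hv'F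

/-! ## §3 An all-black box is crossed both ways, whatever the diagonals -/

/-- AN ALL-BLACK `w × h` BOX (`w, h ≥ 1`) is crossed from left to right (along its bottom row). [folklore] -/
theorem frsw_mem_lrCross_of_allBlack (a b : ℤ) {w h : ℕ} (hw : 1 ≤ w) (hh : 1 ≤ h) (x : Obs)
    (hblack : ∀ v : Site 2, a ≤ v 0 → v 0 < a + w → b ≤ v 1 → v 1 < b + h → v ∈ x.1) :
    x ∈ lrCross a b w h := by
  obtain ⟨m, rfl⟩ : ∃ m, w = m + 1 := ⟨w - 1, by omega⟩
  have hmem : ∀ i : ℕ, i ≤ m → (![a, b] : Site 2) + (i : ℤ) • ![1, 0] ∈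
      {v : Site 2 | a ≤ v 0 ∧ v 0 < a + (m + 1 : ℕ) ∧ b ≤ v 1 ∧ v 1 < b + h} := by
    intro i hi
    simp only [Set.mem_setOf_eq, (crsw_hrun_apply a b i).1, (crsw_hrun_apply a b i).2]
    push_cast
    omega
  have hbl : ∀ i : ℕ, i ≤ m → (![a, b] : Site 2) + (i : ℤ) • ![1, 0] ∈ x.1 := by
    intro i hi
    have h := hmem i hi
    exact hblack _ h.1 h.2.1 h.2.2.1 h.2.2.2
  have hreach := crsw_reachable_of_blackRun x _ ![a, b] ![1, 0] (Or.inl rfl) m hmem hbl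
  simp only [lrCross, Set.mem_setOf_eq, mem_openCrossing_iff]
  refine ⟨(![a, b] : Site 2) + ((0 : ℕ) : ℤ) • ![1, 0], ?_, (![a, b] : Site 2) + ((m : ℕ) : ℤ) • ![1, 0],
    ?_, ⟨hmem 0 (Nat.zero_le _), hmem _ le_rfl, hreach⟩⟩
  · simp only [(crsw_hrun_apply a b 0).1, (crsw_hrun_apply a b 0).2]
    push_cast
    omega
  · simp only [(crsw_hrun_apply a b m).1, (crsw_hrun_apply a b m).2]
    push_cast
    omega

/-- AN ALL-BLACK `w × h` BOX (`w, h ≥ 1`) is crossed from bottom to top (along its left column). [folklore] -/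
theorem frsw_mem_tbCross_of_allBlack (a b : ℤ) {w h : ℕ} (hw : 1 ≤ w) (hh : 1 ≤ h) (x : Obs)
    (hblack : ∀ v : Site 2, a ≤ v 0 → v 0 < a + w → b ≤ v 1 → v 1 < b + h → v ∈ x.1) :
    x ∈ tbCross a b w h := by
  obtain ⟨m, rfl⟩ : ∃ m, h = m + 1 := ⟨h - 1, by omega⟩
  have hmem : ∀ i : ℕ, i ≤ m → (![a, b] : Site 2) + (i : ℤ) • ![0, 1] ∈
      {v : Site 2 | a ≤ v 0 ∧ v 0 < a + w ∧ b ≤ v 1 ∧ v 1 < b + (m + 1 : ℕ)} := by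
    intro i hi
    simp only [Set.mem_setOf_eq, (crsw_vrun_apply a b i).1, (crsw_vrun_apply a b i).2]
    push_cast
    omega
  have hbl : ∀ i : ℕ, i ≤ m → (![a, b] : Site 2) + (i : ℤ) • ![0, 1] ∈ x.1 := by
    intro i hi
    have h := hmem i hi
    exact hblack _ h.1 h.2.1 h.2.2.1 h.2.2.2
  have hreach := crsw_reachable_of_blackRun x _ ![a, b] ![0, 1] (Or.inr rfl) m hmem hbl
  simp only [tbCross, Set.mem_setOf_eq, mem_openCrossing_iff]
  refine ⟨(![a, b] : Site 2) + ((0 : ℕ) : ℤ) • ![0, 1], ?_, (![a, b] : Site 2) + ((m : ℕ) : ℤ) • ![0, 1],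
    ?_, ⟨hmem 0 (Nat.zero_le _), hmem _ le_rfl, hreach⟩⟩
  · simp only [(crsw_vrun_apply a b 0).1, (crsw_vrun_apply a b 0).2]
    push_cast
    omega
  · simp only [(crsw_vrun_apply a b m).1, (crsw_vrun_apply a b m).2]
    push_cast
    omega

end Summit.CriticalPhenomena.CardyFormulaZ2.Theorems.IKLinearTransport.PinnedDiagramExchange

end
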